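import Literature.MathematicalPhysics.QuantumFieldTheory.Balaban1983to89.B4Cor23RegionEta
import Literature.MathematicalPhysics.QuantumFieldTheory.Balaban1983to89.B4Prop31Energy

/-!
# `Balaban1983to89.B1Prop22RegularFieldAlg` — T. Bałaban, *(Higgs)₂,₃ quantum fields in a finite volume. I. A lower bound*,
# Commun. Math. Phys. **85** (1982) 603–626 [Balaban1982Higgs1]: **Proposition 2.2** (2.27)–(2.29) p. 611 AT `A ≠ 0`, I —
# the ALGEBRA: `Δ^{(k)}(Ω,A) = a_kI − a_k²Q_k(A)G_k(Ω,A)Q_k^*(A)` ((2.21) = B4 (1.14)) as a matrix on the unit sites of a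
# region of the B4 cell (block transporters `U(A(Γ_{y,x}))` along the staircase contours), its block bilinear forms, the
# EXACT form of (2.28) `δΔ^{(k)}(Ω,Ω₀,A) = −a_k²Q_kδG_k(Ω,Ω₀,A)Q_k^*` on `Ω^{(k)}`, and the sources `f_{y,v} = η^{(d+1)/2}Q_k^*(A)(vδ_y)`
# (companion `B1Prop22RegularField` = the geometry, the dictionary instance and Proposition 2.2 itself)

statement-level skeleton of published theorems with citation tags; proofs where landed; nothing here is a claim about the Yang–Mills mass gap

PDF held: `paper:balaban1982-cmp85-higgs23-i` (journal page = PDF page + 602), pp. 609–611 read as images on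
`run/shared/lean/pub/pub-balaban/b2b-balaban-ref1/pages/1982-cmp85-higgs23-I/1982-cmp85-higgs23-I-p007…p009-x2.png`;
B4 = [Balaban1983RegularityDecay] pp. 572–573 (`…/1983-cmp89-regularity-decay/…-p002, p003-x2.png`, journal page = PDF
page + 570).

CITATION HEADER (lean-in-tree rule).  Cell `lit-balaban` (HOME `run/shared/lean/pub/lit-balaban/`), Phase-2 proof seat
**p17** gen 2 (unit `lit-balaban-p17-g2`); SKELETON row **B1.Prop2.2** (decl of record `…B1.Prop22Small`, carrier
`…B1.DeltaSetting`, pub-balaban pv07 — UNCHANGED; this file = part 1/2 of the `A ≠ 0` model instance); fold owners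
r01/r14, referee ref-4.  USED BY NAME, never restated (pub-balaban b04 lineage, files untouched):
`B4Lemma21Region.regionOp` (`−Δ^{η,N}_{A,Ω} + m² + a_kP_k(A)` (1.6) with the transporters `B4Cor23RegionDeltaAlg.trn`
along `B4Lower18RegularRegion.rstairContour`), `B4Prop31Energy.keff` ((1.14) for arbitrary region data),
`B4Cor23RegionDeltaAlg.{extV, dGv, contourTrans_incl, extV_dotProduct}` (the nested-region algebra of (1.11)),
`B4Cor23RegionEta.RegularPairInstance` (the family index), `B4Lower18.card_filter_rblk` (`n^{d+1}` points per block).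

WHAT IS PRINTED (verbatim).  I p. 610: *"⟨ψ, Δ^{(k),L^kε}(Ω, A)ψ⟩ = a_k(L^kε)^{−2}⟨ψ, ψ⟩ − a_k²(L^kε)^{−4}⟨ψ,
Q_k(A)G^ε_k(Ω, A)Q_k^*(A)ψ⟩.  (2.21)"*; I p. 611: *"Putting for Ω ⊂ Ω₀ δΔ^{(k)}(Ω, Ω₀, A) = Δ^{(k)}(Ω, A) − Δ^{(k)}(Ω₀, A),
(2.28)"*; I p. 609: *"(Q(A)φ)(y) = Σ_{x∈B(y)} η^d U(A(Γ_{y,x}))φ(x) … (2.11)"* (block averages with parallel transport; adjoint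
for the scalar product (1.5)); B4 p. 573: *"Δ^{(k)}(Ω, A) = a_kI − a_k²Q_k(A)G_k(Ω, A)Q_k^*(A) (1.14)"*, *"δG_k(Ω,Ω₀,A) =
G_k(Ω,A) − G_k(Ω₀,A) (1.11)"*.

DICTIONARY (print ↦ Lean; lattice units `η = 1/n`, counting pairings as in the b04 lineage, space-time dimension `d+1`).
`Q_k(A) = η^{d+1}·Q`, `Q = avgR = avgOp (rBlkWt …) (trn …)` the transported block sums inside `regionOp`, `Q_k^*(A) = Qᵀ`
(weight-`η^{d+1}` pairing on the fine lattice, counting pairing on the unit lattice), `G_k(Ω,A) = (regionOp …)⁻¹`; hence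
(1.14) rescaled to the unit lattice is the matrix `deltaK = a·1 − a²η^{d+1}·Q G Qᵀ = keff …` on `Ω^{(k)} × {1,…,N}`
(`a` = the print's `a_k`).  `vδ_y` = `single y v`; the sources `f_{y,v} = η^{(d+1)/2}·Qᵀ(vδ_y)` (`src`), normalised so
that `‖f_{y,v}‖₂ = |v|` in the counting norm (`src_dot_self`), `supp f_{y,v} = B(y)` (`mem_bsupp_src_iff`).

WHAT IS PROVED (kernel-checked, zero `sorry`, no `def … : Prop`; axioms standard).
* §1 `fld_avgOpT_single`: `Q_k^*(A)(vδ_y)(x) = q(y,x)U(A(Γ_{y,x}))ᵀv`; `keff_bilin`: `⟨ψ,Δ^{(k)}ψ′⟩ = a⟨ψ,ψ′⟩ − a²s⟨Qᵀψ, GQᵀψ′⟩`.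
* §2 `deltaK` (= `keff` on the region data; `deltaK_eq`), `single_deltaK_single` ((2.21) on one-site configurations),
  **`avgRT_single_incl`** (`Q_k^*(A)` of `Ω₀` on `vδ_y`, `y ∈ Ω^{(k)}`, is the extension by zero of `Q_k^*(A)` of `Ω`:
  same block, weights, transporters — b04's `contourTrans_incl`), **`single_deltaK_sub`** ((2.28) exactly:
  `⟨vδ_y, δΔ^{(k)}v′δ_{y′}⟩ = −a²η^{d+1}⟨Qᵀvδ_y, δG_k(Ω,Ω₀,A)Qᵀv′δ_{y′}⟩`, the diagonal cancels, (1.11) `dGv` appears).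
* §3 `src`, `fld_src`, `trnT_dot_self` (`|U(A(Γ))ᵀv| = |v|`), **`src_dot_self`** (`‖f_{y,v}‖₂² = |v|²`), `abs_src_le`
  (`|f_{y,v}(x,i)| ≤ 1` for `|v| = 1`), `mem_bsupp_src_iff` (`supp f_{y,v} = B(y)`).
Nothing here is an estimate; Proposition 2.2 itself is `B1Prop22RegularField.prop22Small_regularPair`.
-/

namespace Literature.MathematicalPhysics.QuantumFieldTheory.Balaban1983to89.B1Prop22RegularFieldAlg


open Finset Matrix
open Literature.MathematicalPhysics.QuantumFieldTheory.Balaban1983to89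
open Literature.MathematicalPhysics.QuantumFieldTheory.Balaban1983to89.B4GaugeCovariance (OrthFlow fld fld_apply blockOp
  blockOp_apply avgOp contourTrans)
open Literature.MathematicalPhysics.QuantumFieldTheory.Balaban1983to89.B4Lower18 (fineDom mem_fineDom fineDom_isBlockUnion
  edistR rblk card_filter_rblk)
open Literature.MathematicalPhysics.QuantumFieldTheory.Balaban1983to89.B4Lower18Regular (transport_fieldLink
  orth_dotProduct_mulVec_self dotProduct_eq_sum_fld dotProduct_self_nonneg' rot_lipschitz)
open Literature.MathematicalPhysics.QuantumFieldTheory.Balaban1983to89.B4Lower18RegularRegion (regWt rBlkWt rbaseEmb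
  rstairContour compField rbaseEmb_blk)
open Literature.MathematicalPhysics.QuantumFieldTheory.Balaban1983to89.B4Lemma21Region (regionOp)
open Literature.MathematicalPhysics.QuantumFieldTheory.Balaban1983to89.B4Reflection242 (blk)
open Literature.MathematicalPhysics.QuantumFieldTheory.Balaban1983to89.B4TwoRegion120 (incl incl_injective)
open Literature.MathematicalPhysics.QuantumFieldTheory.Balaban1983to89.B4Cor23Zero (edistR_self edistR_comm edistR_triangle)
open Literature.MathematicalPhysics.QuantumFieldTheory.Balaban1983to89.B4Cor23ZeroDelta (setDist setDist_le outR mem_outR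
  inclEmb edistR_incl)
open Literature.MathematicalPhysics.QuantumFieldTheory.Balaban1983to89.B4Cor23Region (bsupp bsuppDist bl2n)
open Literature.MathematicalPhysics.QuantumFieldTheory.Balaban1983to89.B4Cor23RegionDeltaAlg (extV resV dGv fineDom_mono lnk
  trn contourTrans_incl extV_dotProduct extV_smul fld_extV_incl fld_extV_of_not_mem ext_of_fld fld_smul')
open Literature.MathematicalPhysics.QuantumFieldTheory.Balaban1983to89.B4Cor23RegionDelta (bdistV)
open Literature.MathematicalPhysics.QuantumFieldTheory.Balaban1983to89.B4Cor23RegionEta (RegularPairInstance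
  regularPairSetting pairR deltaG dpairR cor23Printed_regularPair)
open Literature.MathematicalPhysics.QuantumFieldTheory.Balaban1983to89.B4Prop31Energy (keff)
open Literature.MathematicalPhysics.QuantumFieldTheory.Balaban1983to89.B4BoxCov237 (supNorm_sub_le_of_blk_eq)

noncomputable section

variable {d : ℕ} {ι : Type} [Fintype ι] [DecidableEq ι]

/-! ## §1. `vδ_y` and the block bilinear forms of `Q^T` and of (1.14) -/

/-- the unit-lattice configuration `vδ_y` (value `v ∈ R^N` at the unit site `y`, zero elsewhere) — the one-site test
configurations of the kernel `Δ^{(k)}(Ω,A; y, y′)` in (2.27). [cite: Balaban1982Higgs1, (2.27) p.611] -/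
def single {Y : Type} [DecidableEq Y] (y : Y) (v : ι → ℝ) : Y × ι → ℝ := fun j => if j.1 = y then v j.2 else 0

omit [DecidableEq ι] in
/-- `⟨vδ_y, v′δ_{y′}⟩ = (v·v′)δ_{yy′}`. [cite: Balaban1982Higgs1, (2.27) p.611] -/
theorem single_dotProduct_single {Y : Type} [Fintype Y] [DecidableEq Y] (y y' : Y) (v v' : ι → ℝ) :
    single y v ⬝ᵥ single y' v' = if y = y' then v ⬝ᵥ v' else 0 := by
  simp only [dotProduct, Fintype.sum_prod_type, single]
  by_cases h : y = y'
  · subst h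
    rw [if_pos rfl, Finset.sum_eq_single y (fun b _ hb => by simp [hb]) (by simp)]
    simp
  · rw [if_neg h]
    refine Finset.sum_eq_zero fun b _ => Finset.sum_eq_zero fun i _ => ?_
    by_cases hb : b = y
    · subst hb; simp [h]
    · simp [hb]

omit [DecidableEq ι] in
/-- **`Q_k^*(A)(vδ_y)(x) = q(y,x)·U(A(Γ_{y,x}))ᵀv`** — the adjoint averaging operator on a one-site configuration
(I (2.11) with the weight-one adjoint; B4 (1.4)). [cite: Balaban1983RegularityDecay, p. 572 (1.4)] -/
theorem fld_avgOpT_single {X Y : Type} [Fintype X] [Fintype Y] [DecidableEq Y] (q : Y → X → ℝ)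
    (T : Y → X → Matrix ι ι ℝ) (y : Y) (v : ι → ℝ) (x : X) :
    fld ((avgOp q T)ᵀ *ᵥ single y v) x = q y x • ((T y x)ᵀ *ᵥ v) := by
  funext i
  simp only [fld_apply, Matrix.mulVec, dotProduct, Fintype.sum_prod_type, Matrix.transpose_apply, avgOp,
    blockOp_apply, Matrix.smul_apply, smul_eq_mul, single, Pi.smul_apply]
  rw [Finset.sum_eq_single y (fun b _ hb => by simp [hb]) (by simp), Finset.mul_sum]
  exact Finset.sum_congr rfl fun j _ => by simp only [if_true]; ring

/-- the bilinear form of (1.14) `keff = a·1 − a²s·QGQᵀ`: `⟨ψ, Δ^{(k)}ψ′⟩ = a⟨ψ,ψ′⟩ − a²s⟨Qᵀψ, GQᵀψ′⟩`.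
[cite: Balaban1983RegularityDecay, p. 573 (1.14)] -/
theorem keff_bilin {X Y : Type} [Fintype X] [Fintype Y] [DecidableEq X] [DecidableEq Y] (c : X → X → ℝ)
    (m2 a s : ℝ) (q : Y → X → ℝ) (W T : _) (ψ ψ' : Y × ι → ℝ) :
    ψ ⬝ᵥ (keff c m2 a s q W T *ᵥ ψ')
      = a * (ψ ⬝ᵥ ψ') - a ^ 2 * s *
          (((avgOp q T)ᵀ *ᵥ ψ) ⬝ᵥ (B4GaugeCovariance.green c m2 (a * s) q W T *ᵥ ((avgOp q T)ᵀ *ᵥ ψ'))) := by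
  rw [keff, Matrix.sub_mulVec, Matrix.smul_mulVec, Matrix.one_mulVec, dotProduct_sub, dotProduct_smul,
    smul_eq_mul, Matrix.smul_mulVec, dotProduct_smul, smul_eq_mul, ← Matrix.mulVec_mulVec, ← Matrix.mulVec_mulVec,
    Matrix.dotProduct_mulVec ψ (avgOp q T), ← Matrix.mulVec_transpose]

/-! ## §2. `Δ^{(k)}(Ω,A)` (1.14) on a region and its compatibility with `Ω ⊂ Ω₀` -/

section Region

variable (F : OrthFlow ι) (e : ℝ) {n : ℕ} (hn : 1 ≤ n) (a m2 : ℝ) (Ωc : Finset (Fin (d + 1) → ℤ))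
  (Ac : (Fin (d + 1) → ℤ) → Fin (d + 1) → ℝ)

/-- `Q` = the transported block sums of `Ω` (`Q_k(A) = η^{d+1}Q`, `Q_k^*(A) = Qᵀ`), the averaging operator inside
`regionOp`. [cite: Balaban1983RegularityDecay, p. 572 (1.4)] -/
abbrev avgR : Matrix (↥Ωc × ι) (↥(fineDom n Ωc) × ι) ℝ := avgOp (rBlkWt n Ωc (fineDom n Ωc)) (trn F e hn Ωc Ac)

/-- **`Δ^{(k)}(Ω,A) = a_kI − a_k²Q_k(A)G_k(Ω,A)Q_k^*(A)`** (B4 (1.14) = I (2.21) rescaled to the unit lattice) for the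
region `Ω` over the unit labels `Ωc`, the vector field `A_ν(x)`, charge `e`, mesh `1/n`, mass `m²`: b04's `keff` on the
data of `regionOp` (so that its Green's function IS `(regionOp …)⁻¹ = G_k(Ω,A)`, `deltaK_eq`).
[cite: Balaban1982Higgs1, (2.21) p.610; B4 (1.14) p.573] -/
def deltaK : Matrix (↥Ωc × ι) (↥Ωc × ι) ℝ :=
  keff (regWt n (fineDom n Ωc)) m2 a (((n : ℝ) ^ (d + 1))⁻¹) (rBlkWt n Ωc (fineDom n Ωc)) (lnk F e n Ωc Ac)
    (trn F e hn Ωc Ac)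

/-- (1.14) unfolded on the region: `Δ^{(k)}(Ω,A) = a·1 − a²η^{d+1}·Q G_k(Ω,A) Qᵀ`. [cite: Balaban1983RegularityDecay, p. 573 (1.14)] -/
theorem deltaK_eq : deltaK F e hn a m2 Ωc Ac = a • (1 : Matrix _ _ ℝ)
    - (a ^ 2 * ((n : ℝ) ^ (d + 1))⁻¹) • (avgR F e hn Ωc Ac * (regionOp F e hn a m2 Ωc Ac)⁻¹ * (avgR F e hn Ωc Ac)ᵀ) :=
  rfl

/-- `⟨vδ_y, Δ^{(k)}(Ω,A)v′δ_{y′}⟩ = a(v·v′)δ_{yy′} − a²η^{d+1}⟨Qᵀvδ_y, G_k(Ω,A)Qᵀv′δ_{y′}⟩`.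
[cite: Balaban1982Higgs1, (2.21) p.610] -/
theorem single_deltaK_single (y y' : ↥Ωc) (v v' : ι → ℝ) :
    single y v ⬝ᵥ (deltaK F e hn a m2 Ωc Ac *ᵥ single y' v')
      = a * (if y = y' then v ⬝ᵥ v' else 0) - a ^ 2 * ((n : ℝ) ^ (d + 1))⁻¹ *
          (((avgR F e hn Ωc Ac)ᵀ *ᵥ single y v) ⬝ᵥ
            ((regionOp F e hn a m2 Ωc Ac)⁻¹ *ᵥ ((avgR F e hn Ωc Ac)ᵀ *ᵥ single y' v'))) := by
  rw [deltaK, keff_bilin, single_dotProduct_single]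
  rfl

variable {Ωc} {Ω₀c : Finset (Fin (d + 1) → ℤ)} (hΩ : Ωc ⊆ Ω₀c)

include hΩ in
/-- **`Q_k^*(A)` OF `Ω₀` ON `vδ_y`, `y ∈ Ω^{(k)}`, IS THE EXTENSION BY ZERO OF `Q_k^*(A)` OF `Ω` ON `vδ_y`** (the block `B(y)`,
its weights and its transporters are the same in `Ω` and `Ω₀`: b04's `contourTrans_incl`).
[cite: Balaban1983RegularityDecay, p. 572 (1.4) «Γ^{(k)}_{y,x}»; p. 573 (1.11)] -/
theorem avgRT_single_incl (y : ↥Ωc) (v : ι → ℝ) :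
    (avgR F e hn Ω₀c Ac)ᵀ *ᵥ single (incl hΩ y) v
      = extV (fineDom n Ω₀c) ((avgR F e hn Ωc Ac)ᵀ *ᵥ single y v) := by
  have hR := fineDom_mono hn hΩ
  refine ext_of_fld fun z => ?_
  rw [fld_avgOpT_single]
  by_cases hz : z.1 ∈ fineDom n Ωc
  · obtain ⟨x, rfl⟩ : ∃ x : ↥(fineDom n Ωc), z = incl hR x := ⟨⟨z.1, hz⟩, Subtype.ext rfl⟩
    rw [fld_extV_incl, fld_avgOpT_single]
    unfold trn lnk
    rw [contourTrans_incl F (e / n) hn hΩ Ac y x]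
    rfl
  · rw [fld_extV_of_not_mem _ z hz]
    have : rBlkWt n Ω₀c (fineDom n Ω₀c) (incl hΩ y) z = 0 := by
      unfold rBlkWt
      rw [if_neg]
      intro hb
      exact hz ((mem_fineDom hn).2 (hb ▸ y.2 : blk n z.1 ∈ Ωc))
    rw [this, zero_smul]

include hΩ in
/-- **(2.28) EXACTLY**: `⟨vδ_y, (Δ^{(k)}(Ω,A) − Δ^{(k)}(Ω₀,A))v′δ_{y′}⟩ = −a²η^{d+1}⟨Qᵀvδ_y, δG_k(Ω,Ω₀,A)Qᵀv′δ_{y′}⟩` for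
`y, y′ ∈ Ω^{(k)}` — the diagonal cancels and (1.11) `δG = G_k(Ω,A) − G_k(Ω₀,A)|_Ω` (`dGv`) appears.
[cite: Balaban1982Higgs1, (2.28) p.611; B4 (1.11) p.573] -/
theorem single_deltaK_sub (y y' : ↥Ωc) (v v' : ι → ℝ) :
    single y v ⬝ᵥ (deltaK F e hn a m2 Ωc Ac *ᵥ single y' v')
        - single (incl hΩ y) v ⬝ᵥ (deltaK F e hn a m2 Ω₀c Ac *ᵥ single (incl hΩ y') v')
      = -(a ^ 2 * ((n : ℝ) ^ (d + 1))⁻¹ *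
          (((avgR F e hn Ωc Ac)ᵀ *ᵥ single y v) ⬝ᵥ
            dGv (fineDom_mono hn hΩ) (regionOp F e hn a m2 Ωc Ac)⁻¹ (regionOp F e hn a m2 Ω₀c Ac)⁻¹
              ((avgR F e hn Ωc Ac)ᵀ *ᵥ single y' v'))) := by
  rw [single_deltaK_single, single_deltaK_single, avgRT_single_incl F e hn Ac hΩ, avgRT_single_incl F e hn Ac hΩ,
    extV_dotProduct (fineDom_mono hn hΩ), dGv, dotProduct_sub]
  have : (incl hΩ y = incl hΩ y') = (y = y') := propext (incl_injective hΩ).eq_iff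
  simp only [this]
  ring

end Region

/-! ## §3. The sources `f_{y,v} = η^{(d+1)/2}·Q_k^*(A)(vδ_y)` of an instance -/

namespace Inst

variable (i : RegularPairInstance d) (F : OrthFlow ι) (a : ℝ)

/-- the block weight `η^{d+1} = n^{−(d+1)}` of `Q_k` ((2.11): `η^d` in `d` space-time dimensions). [cite: Balaban1982Higgs1, (2.11) p.609] -/
def sR : ℝ := ((i.n : ℝ) ^ (d + 1))⁻¹

/-- `Q_k^*(A)(vδ_y) = Qᵀ(vδ_y)` on the fine region of `Ω`. [cite: Balaban1982Higgs1, (2.11) p.609] -/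
def qsrc (y : ↥i.Ωc) (v : ι → ℝ) : ↥(fineDom i.n i.Ωc) × ι → ℝ := (avgR F i.e i.hn i.Ωc i.Ac)ᵀ *ᵥ single y v

/-- the source `f_{y,v} = η^{(d+1)/2}·Q_k^*(A)(vδ_y)` (normalised so that `‖f_{y,v}‖₂ = |v|` in the counting norm).
[cite: Balaban1982Higgs1, (2.11) p.609, (2.21) p.610] -/
def src (y : ↥i.Ωc) (v : ι → ℝ) : ↥(fineDom i.n i.Ωc) × ι → ℝ := Real.sqrt (sR i) • qsrc i F y v

/-- `η^{d+1} > 0`. [cite: Balaban1982Higgs1, (2.11) p.609] -/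
theorem sR_pos : 0 < sR i := by
  have : (0 : ℝ) < i.n := by exact_mod_cast i.hn
  unfold sR; positivity

/-- `η^{d+1} ≤ 1`. [cite: Balaban1982Higgs1, (2.11) p.609] -/
theorem sR_le_one : sR i ≤ 1 := by
  have : (1 : ℝ) ≤ (i.n : ℝ) ^ (d + 1) := one_le_pow₀ (by exact_mod_cast i.hn)
  unfold sR
  exact inv_le_one_of_one_le₀ this

/-- the block transporter is a value of the (orthogonal) flow, hence `|U(A(Γ_{y,x}))ᵀv|² = |v|²` (B4 p. 572: «U is a
representation of the gauge group»). [cite: Balaban1983RegularityDecay, p. 572 (1.2), (1.4)] -/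
theorem trnT_dot_self (y : ↥i.Ωc) (x : ↥(fineDom i.n i.Ωc)) (v : ι → ℝ) :
    ((trn F i.e i.hn i.Ωc i.Ac y x)ᵀ *ᵥ v) ⬝ᵥ ((trn F i.e i.hn i.Ωc i.Ac y x)ᵀ *ᵥ v) = v ⬝ᵥ v := by
  unfold trn lnk contourTrans
  rw [transport_fieldLink, F.transpose_eq]
  exact orth_dotProduct_mulVec_self (F.orth _) v

/-- `f_{y,v}(x) = (η^{(d+1)/2}q(y,x))·U(A(Γ_{y,x}))ᵀv`. [cite: Balaban1982Higgs1, (2.11) p.609] -/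
theorem fld_src (y : ↥i.Ωc) (v : ι → ℝ) (x : ↥(fineDom i.n i.Ωc)) :
    fld (src i F y v) x
      = (Real.sqrt (sR i) * rBlkWt i.n i.Ωc (fineDom i.n i.Ωc) y x) • ((trn F i.e i.hn i.Ωc i.Ac y x)ᵀ *ᵥ v) := by
  rw [src, fld_smul', qsrc, fld_avgOpT_single, smul_smul]

/-- **`‖f_{y,v}‖₂² = |v|²`**: `η^{d+1}·#B(y)·|Uᵀv|² = |v|²` (`n^{d+1}` fine points per block, orthogonal transporters).
[cite: Balaban1982Higgs1, (2.11) p.609] -/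
theorem src_dot_self (y : ↥i.Ωc) (v : ι → ℝ) : src i F y v ⬝ᵥ src i F y v = v ⬝ᵥ v := by
  rw [dotProduct_eq_sum_fld]
  have hq : ∀ x : ↥(fineDom i.n i.Ωc), fld (src i F y v) x ⬝ᵥ fld (src i F y v) x
      = (if blk i.n x.1 = y.1 then 1 else 0) * (sR i * (v ⬝ᵥ v)) := by
    intro x
    rw [fld_src, smul_dotProduct, dotProduct_smul, smul_eq_mul, smul_eq_mul, trnT_dot_self]
    unfold rBlkWt
    split_ifs
    · rw [mul_one, ← mul_assoc, Real.mul_self_sqrt (sR_pos i).le, one_mul]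
    · simp
  simp_rw [hq]
  rw [← Finset.sum_mul, Finset.sum_boole]
  have hy : y.1 ∈ (fineDom i.n i.Ωc).image (blk i.n) :=
    Finset.mem_image.2 ⟨(rbaseEmb i.hn i.Ωc y).1, (rbaseEmb i.hn i.Ωc y).2, rbaseEmb_blk i.hn i.Ωc y⟩
  have hcard := card_filter_rblk i.hn (fineDom_isBlockUnion i.hn i.Ωc) ⟨y.1, hy⟩
  rw [Finset.filter_congr (fun x _ => show rblk i.n _ x = ⟨y.1, hy⟩ ↔ blk i.n x.1 = y.1 from Subtype.ext_iff)] at hcard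
  rw [hcard]
  push_cast
  rw [sR, ← mul_assoc, mul_inv_cancel₀ (pow_ne_zero _ (by have := i.hn; positivity)), one_mul]

/-- `|f_{y,v}(x,i)| ≤ 1` for `|v| = 1`. [cite: Balaban1982Higgs1, (2.11) p.609] -/
theorem abs_src_le (y : ↥i.Ωc) {v : ι → ℝ} (hv : v ⬝ᵥ v = 1) (j : ↥(fineDom i.n i.Ωc) × ι) : |src i F y v j| ≤ 1 := by
  have h := congrFun (fld_src i F y v j.1) j.2
  rw [fld_apply] at h
  rw [show src i F y v j = src i F y v (j.1, j.2) from rfl, h, Pi.smul_apply, smul_eq_mul, abs_mul]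
  have h1 : |Real.sqrt (sR i) * rBlkWt i.n i.Ωc (fineDom i.n i.Ωc) y j.1| ≤ 1 := by
    rw [abs_mul, abs_of_nonneg (Real.sqrt_nonneg _)]
    refine mul_le_one₀ (Real.sqrt_le_one.2 (sR_le_one i)) (abs_nonneg _) ?_
    unfold rBlkWt; split_ifs <;> simp
  have h2 : |((trn F i.e i.hn i.Ωc i.Ac y j.1)ᵀ *ᵥ v) j.2| ≤ 1 := by
    rw [← sq_le_one_iff_abs_le_one, ← hv, ← trnT_dot_self i F y j.1 v, sq]
    exact Finset.single_le_sum (f := fun k => ((trn F i.e i.hn i.Ωc i.Ac y j.1)ᵀ *ᵥ v) k *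
      ((trn F i.e i.hn i.Ωc i.Ac y j.1)ᵀ *ᵥ v) k) (fun k _ => mul_self_nonneg _) (Finset.mem_univ _)
  exact mul_le_one₀ h1 (abs_nonneg _) h2

/-- `supp f_{y,v} = B(y)` for `|v| = 1`: membership. [cite: Balaban1982Higgs1, (2.11) p.609] -/
theorem mem_bsupp_src_iff (y : ↥i.Ωc) {v : ι → ℝ} (hv : v ⬝ᵥ v = 1) (x : ↥(fineDom i.n i.Ωc)) :
    x ∈ bsupp (src i F y v) ↔ blk i.n x.1 = y.1 := by
  rw [bsupp, Finset.mem_filter, and_iff_right (Finset.mem_univ _), fld_src]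
  unfold rBlkWt
  constructor
  · intro h
    by_contra hb
    exact h (by rw [if_neg hb, mul_zero, zero_smul])
  · intro hb h0
    rw [if_pos hb, mul_one] at h0
    have := congrArg (fun w => w ⬝ᵥ w) h0
    simp only [smul_dotProduct, dotProduct_smul, smul_eq_mul, trnT_dot_self, hv, zero_dotProduct, mul_one,
      Real.mul_self_sqrt (sR_pos i).le] at this
    exact (sR_pos i).ne' this

end Inst

end

end Literature.MathematicalPhysics.QuantumFieldTheory.Balaban1983to89.B1Prop22RegularFieldAlg
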